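import Summits.ABC.ABC.Theses.RibetTakahashiSplit
import Summits.ABC.ABC.Theorems.RibetTakahashiSplitValuationProductOfCurves
import HarnessLib

/-!
# The Frey part of the few-prime crux `FewPrimeValuationProduct`

Helper (`--supports`) for the line `matveev-face-clearing` of the crux
`Summit.ABC.ABC.Theses.RibetTakahashiSplit.FewPrimeValuationProduct` (stmt-ABC-1563): the
registered sub-goal `freyFewPrime_of_fewPrimeValuationProduct`, the NECESSITY direction of the
line's reshape.

The crux r4 says `T(E) := ∏_{p ∥ N_E} v_p(Δ_min(E)) ≤ C_ε N_E^ε` for every elliptic curve `E/ℚ`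
semistable away from `2` with `≤ 3` odd multiplicative primes. Its "Frey part" is the
valuation-product bound `∏_{p ∣ abc} v_p(abc) ≤ K_ε rad(abc)^ε` on every abc triple `a + b = c`
with `ω(abc) ≤ 4`. Proof: the landed Frey translation
`Summit.ABC.ABC.Theorems.ValuationProductOfCurves.exists_curve` attaches to the triple a curve `W`,
semistable away from `2`, with `N_W ∣ 2¹⁰ rad(abc)` and `∏_{p ∣ abc} v_p(abc) ≤ 4 T(W)`. Every odd
multiplicative prime of `W` divides `N_W ∣ 2¹⁰ rad(abc)`, hence is an odd prime of `abc`; and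
`2 ∣ abc` (if `a`, `b` are odd then `c = a + b` is even), so `W` has `≤ ω(abc) − 1 ≤ 3` odd
multiplicative primes and the crux applies: `T(W) ≤ C N_W^ε ≤ C 2^{10ε} rad(abc)^ε`, whence
`K_ε = 4 · max(C, 0) · 2^{10ε}` (the bookkeeping of `valuationProductOfCurves_proof`).

## References

* E. Bombieri, W. Gubler, *Heights in Diophantine Geometry*, New Math. Monogr. 4, CUP 2006,
  Example 12.5.10. [BombieriGubler2006]
* H. Pasten, *Shimura curves and the abc conjecture*, J. Number Theory 254 (2024), §16.
  [PastenShimura2024]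
-/

-- `Summit.ABC.ABC` is the mandated summit-side namespace (CONVENTIONS §2); the duplicate is
-- deliberate.
set_option linter.dupNamespace false

noncomputable section

namespace Summit.ABC.ABC.Theorems.FewPrimeValuationProduct

open WeierstrassCurve UniqueFactorizationMonoid
open Literature.NumberTheory.DiophantineGeometry

/-- For an abc triple, `2 ∣ abc`: if `a` and `b` are odd then `c = a + b` is even. [folklore] -/
private theorem two_mem_primeFactors {a b c : ℕ} (h : IsABCTriple a b c) :
    2 ∈ (a * b * c).primeFactors := by
  obtain ⟨ha, hb, habc, -⟩ := h
  have hc : 0 < c := by omega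
  have h0 : a * b * c ≠ 0 := by positivity
  have h2 : 2 ∣ a * b * c := by
    by_contra hnot
    have h2a : ¬ 2 ∣ a := fun h2a => hnot (dvd_mul_of_dvd_left (dvd_mul_of_dvd_left h2a b) c)
    have h2b : ¬ 2 ∣ b := fun h2b => hnot (dvd_mul_of_dvd_left (dvd_mul_of_dvd_right h2b a) c)
    have h2c : 2 ∣ c := by omega
    exact hnot (dvd_mul_of_dvd_right h2c _)
  exact Nat.mem_primeFactors.mpr ⟨Nat.prime_two, h2, h0⟩

/-- The odd multiplicative primes of a curve whose conductor divides `2¹⁰ rad(abc)` are odd primes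
of `abc`. [folklore] -/
private theorem oddMultiplicative_subset {a b c : ℕ} (h0 : a * b * c ≠ 0) {N : ℕ}
    (hN : N ∣ 2 ^ 10 * rad a b c) :
    N.primeFactors.filter (fun p => p ≠ 2 ∧ ¬ p ^ 2 ∣ N) ⊆ (a * b * c).primeFactors.erase 2 := by
  intro p hp
  obtain ⟨hpN, hp2, -⟩ := Finset.mem_filter.mp hp
  obtain ⟨hp, hpdvd, -⟩ := Nat.mem_primeFactors.mp hpN
  refine Finset.mem_erase.mpr ⟨hp2, Nat.mem_primeFactors.mpr ⟨hp, ?_, h0⟩⟩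
  rcases (Nat.Prime.dvd_mul hp).mp (hpdvd.trans hN) with h2 | hrad
  · exact absurd ((Nat.prime_dvd_prime_iff_eq hp Nat.prime_two).mp (hp.dvd_of_dvd_pow h2)) hp2
  · rw [rad_def] at hrad
    exact hrad.trans radical_dvd_self

/-- **The Frey part of the few-prime crux (sub-goal `freyFewPrime_of_fewPrimeValuationProduct` of
the line `matveev-face-clearing`, item stmt-ABC-1563).** The crux r4 `FewPrimeValuationProduct`
(`T(E) ≤ C_ε N_E^ε` for curves semistable away from `2` with `≤ 3` odd multiplicative primes)
implies the valuation-product bound `∏_{p ∣ abc} v_p(abc) ≤ K_ε rad(abc)^ε` on every abc triple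
with `ω(abc) ≤ 4`: the Frey curve of the triple (`ValuationProductOfCurves.exists_curve`) has
`≤ ω(abc) − 1 ≤ 3` odd multiplicative primes since `2 ∣ abc` and `N ∣ 2¹⁰ rad(abc)`;
`K = 4 max(C, 0) 2^{10ε}`. [folklore] -/
theorem freyFewPrime_of_fewPrimeValuationProduct :
    Summit.ABC.ABC.Theses.RibetTakahashiSplit.FewPrimeValuationProduct → ∀ ε : ℝ, 0 < ε →
      ∃ K : ℝ, ∀ a b c : ℕ, Literature.NumberTheory.DiophantineGeometry.IsABCTriple a b c →
        (a * b * c).primeFactors.card ≤ 4 →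
          ((∏ p ∈ (a * b * c).primeFactors, (a * b * c).factorization p : ℕ) : ℝ) ≤
            K * (Literature.NumberTheory.DiophantineGeometry.rad a b c : ℝ) ^ ε := by
  intro hR4 ε hε
  obtain ⟨C₄, hC₄⟩ := hR4 ε hε
  set C : ℝ := max C₄ 0
  have hC0 : 0 ≤ C := le_max_right _ _
  refine ⟨4 * C * ((2 : ℝ) ^ 10) ^ ε, fun a b c h hcard => ?_⟩
  have h0 : a * b * c ≠ 0 := by
    obtain ⟨ha, hb, habc, -⟩ := h
    have hc : 0 < c := by omega
    positivity
  obtain ⟨W, hE, hss, -, hN, hprod⟩ := ValuationProductOfCurves.exists_curve h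
  haveI := hE
  -- `W` has at most `ω(abc) - 1 ≤ 3` odd multiplicative primes
  have h3 : ((W.conductorNorm ℤ).primeFactors.filter
      (fun p => p ≠ 2 ∧ ¬ p ^ 2 ∣ W.conductorNorm ℤ)).card ≤ 3 :=
    calc ((W.conductorNorm ℤ).primeFactors.filter
          (fun p => p ≠ 2 ∧ ¬ p ^ 2 ∣ W.conductorNorm ℤ)).card
        ≤ ((a * b * c).primeFactors.erase 2).card :=
          Finset.card_le_card (oddMultiplicative_subset h0 hN)
      _ = (a * b * c).primeFactors.card - 1 := Finset.card_erase_of_mem (two_mem_primeFactors h)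
      _ ≤ 3 := by omega
  have key : (multiplicativeValuationProduct W : ℝ) ≤ C * (W.conductorNorm ℤ : ℝ) ^ ε := by
    have hNε : 0 ≤ (W.conductorNorm ℤ : ℝ) ^ ε := by positivity
    exact (hC₄ W hss h3).trans (mul_le_mul_of_nonneg_right (le_max_left _ _) hNε)
  set N : ℝ := ((W.conductorNorm ℤ : ℕ) : ℝ) with hNdef
  set R : ℝ := ((rad a b c : ℕ) : ℝ) with hRdef
  have hR0 : 0 < R := by
    rw [hRdef, rad_def]; exact_mod_cast Nat.radical_pos _
  have hNR : N ≤ 2 ^ 10 * R := by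
    have := Nat.le_of_dvd (mul_pos (by positivity) (by rw [rad_def]; exact Nat.radical_pos _)) hN
    rw [hNdef, hRdef]; exact_mod_cast this
  calc ((∏ p ∈ (a * b * c).primeFactors, (a * b * c).factorization p : ℕ) : ℝ)
      ≤ ((4 * multiplicativeValuationProduct W : ℕ) : ℝ) := by exact_mod_cast hprod
    _ = 4 * (multiplicativeValuationProduct W : ℝ) := by push_cast; ring
    _ ≤ 4 * (C * N ^ ε) := by gcongr
    _ ≤ 4 * (C * (2 ^ 10 * R) ^ ε) := by gcongr
    _ = 4 * C * ((2 : ℝ) ^ 10) ^ ε * R ^ ε := by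
        rw [Real.mul_rpow (by positivity) hR0.le]; ring

end Summit.ABC.ABC.Theorems.FewPrimeValuationProduct

end
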